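import Mathlib
import Summits.NavierStokesRegularity.NavierStokesRegularity.Theses.RootDecompThresholdSaddle
import Summits.NavierStokesRegularity.NavierStokesRegularity.Theses.RootDecompFactorLadder
import Summits.NavierStokesRegularity.NavierStokesRegularity.Theorems.RootDecompFactorLadderTwoFactorTransfer
import Summits.NavierStokesRegularity.NavierStokesRegularity.Theorems.RootDecompThresholdSaddleWallOfCells
import Literature.Analysis.FluidPDE.SelfSimilar
import Literature.Analysis.FluidPDE.SelfSimilarLiouville
import Literature.Analysis.FluidPDE.MildSolution

/-!
# N26 «THE FACTOR LADDER» / N15 «THRESHOLD SADDLE» · THE FAKE BREATHER — certified misstatements of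
  B `IsolatedFactorLiouville` (stmt-33310) and C `CoarseRatioLargeEnvelopeDssLiouville` (stmt-31466)

Lens-1 g17 «THE FAKE BREATHER» (HOME/decomp-ns-lens-1/FakeBreather.lean §0–§2, critic row 208 CERTIFIED
MISSTATEMENT ACCEPTED; booking step 2 «certificates --supports 29252»), re-typed on the TREE decls and def-free.

MECHANISM.  W's class (`IsAncientMildSolution 1 u`, measurable slices `t < 0`, Type-I envelope `HasTypeIDecay`)
reads ONLY the past `t < 0` of a field `u : ℝ → ℝ³ → ℝ³`, while `IsRotatedDSS c R u` quantifies over ALL `t`.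
Hence a `(c, R)`-RDSS member can be modified on `t ≥ 0` only — glue the junk slice
`x ↦ ψ_c(‖x‖) • x`, `ψ_c(r) = r⁻²` on the radius lattice `r ∈ c^ℤ` and `0` off it — into a member with the SAME
past, still `(c, R)`-RDSS, admitting NO rotated-DSS symmetry with factor in `(1, c)` (`exists_junk_extension`).
Consequences, all kernel-checked below:

* `isolated_iff_wall` — **B ⟺ W**: N26's declared residual B («isolated factor set», tagged WEAKER than W) IS the
  wall W `TypeIDssWall` (stmt-29252) as typed; so `isolated_iff_wall_and_accumulating` — **B ⟺ W ∧ A** —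
  N26's cut `W ⟺ A ∧ B` is void on the B side.
* `coarse_iff_coarse_and_fine` — **C ⟺ C ∧ F** on N15: `CoarseRatioLargeEnvelopeDssLiouville` (stmt-31466) swallows
  `FineRatioLargeEnvelopeDssLiouville` (stmt-31465); with the landed glue `TypeIDssWall_of_cells` this gives
  `wall_iff_small_and_coarse` — **W ⟺ T ∧ C** — N15's dial 2 is void as typed.
  Every certificate is an `Iff`, so no route item is the head symbol of a landed theorem (no closure credit).
* `wall_iff_repaired` — **W ⟺ REG ∧ A ∧ B^R** (N26 rev 3 exact) and `wall_iff_repaired_cells` —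
  **W ⟺ T ∧ F ∧ C^R ∧ REG** (the N15 resplit kit), with `wall_iff_wall_and_reg` (W ⟹ REG, `V := 0`).

The repair (B^R `PastIsolatedFactorLiouville` 27744, C^R `PastCoarseRatioLargeEnvelopeDssLiouville` 27776, REG
`TypeIRdssRepresentative` 27745: read the symmetry dial on PINNED, past-continuous representatives) is filed as N26
rev 3 and banked on N15; B 33310 is retired `aside` as a settled costume of W.
No defs: the junk weight and the glued field are ∃-abstracted / hypothesised by their defining equations.

Sources: Bradshaw–Tsai arXiv:1610.05680 §1, §5 OP 5.1 (RDSS fields); Chae–Wolf arXiv:1610.09464; KNSS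
arXiv:0709.3599 §6; tree `RootDecompFactorLadderTwoFactorTransfer.isRotatedDSS_pow_exists` (group law).
-/

set_option linter.dupNamespace false

namespace Summit.NavierStokesRegularity.NavierStokesRegularity.Theorems.RootDecompFactorLadderFakeBreather

open Summit.NavierStokesRegularity.NavierStokesRegularity.Theses
open Summit.NavierStokesRegularity.NavierStokesRegularity.Theorems
open scoped Topology RealInnerProductSpace
open Filter Set MeasureTheory Function
open Literature.Analysis.FluidPDE

/-! ## §0 Past-only dependence of the class -/

section PastOnly

variable {E : Type*} [NormedAddCommGroup E] [InnerProductSpace ℝ E] [FiniteDimensional ℝ E]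
  [MeasurableSpace E] [BorelSpace E]

/-- **The ancient-mild class reads only the past.** The two-time duality identity between `s < t < 0`
integrates the slices over `[s, t] ⊂ (−∞, 0)`; weak divergence-freeness is asked at `t < 0` only. -/
theorem isAncientMildSolution_congr {ν : ℝ} {u v : ℝ → E → E} (h : IsAncientMildSolution ν u)
    (heq : ∀ t : ℝ, t < 0 → v t = u t) : IsAncientMildSolution ν v := by
  refine ⟨fun t ht => by rw [heq t ht]; exact h.1 t ht, fun s t hst ht φ hφ hdiv => ?_⟩
  have key := h.2 s t hst ht φ hφ hdiv
  have hs : s < 0 := hst.trans ht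
  have hI : ∀ τ ∈ uIcc s t, v τ = u τ := fun τ hτ => by
    rw [uIcc_of_le hst.le] at hτ
    exact heq τ (lt_of_le_of_lt hτ.2 ht)
  have hint : (∫ τ in s..t, ∫ x, ⟪v τ x, convect (v τ) (heatTest ν φ (t - τ)) x⟫) =
      ∫ τ in s..t, ∫ x, ⟪u τ x, convect (u τ) (heatTest ν φ (t - τ)) x⟫ :=
    intervalIntegral.integral_congr fun τ hτ => by simp only [hI τ hτ]
  rw [heq t ht, heq s hs, hint]
  exact key

omit [InnerProductSpace ℝ E] [FiniteDimensional ℝ E] [MeasurableSpace E] [BorelSpace E] in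
/-- Type-I decay reads only the past. -/
theorem hasTypeIDecay_congr [NormedSpace ℝ E] {C : ℝ} {u v : ℝ → E → E} (h : HasTypeIDecay C u)
    (heq : ∀ t : ℝ, t < 0 → v t = u t) : HasTypeIDecay C v :=
  fun t ht x => by rw [heq t ht]; exact h t ht x

end PastOnly

/-! ## §1 The junk slice (def-free: the weight `w` is hypothesised by its defining equation) -/

section Junk

variable {E : Type*} [NormedAddCommGroup E] [NormedSpace ℝ E]

/-- Membership in the radius lattice `c^ℤ` is invariant under multiplication by `c`. -/
theorem mem_range_zpow_mul_iff {c r : ℝ} (hc : 1 < c) :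
    c * r ∈ Set.range (fun n : ℤ => c ^ n) ↔ r ∈ Set.range (fun n : ℤ => c ^ n) := by
  have hc0 : c ≠ 0 := by positivity
  constructor
  · rintro ⟨n, hn⟩
    simp only at hn
    refine ⟨n - 1, ?_⟩
    simp only
    rw [zpow_sub_one₀ hc0, hn]
    field_simp
  · rintro ⟨n, hn⟩
    simp only at hn
    refine ⟨n + 1, ?_⟩
    simp only
    rw [zpow_add_one₀ hc0, hn, mul_comm]

open scoped Classical in
/-- Scaling law of the lattice weight `ψ_c(r) = r⁻²` on `c^ℤ`, `0` off it: `c ψ_c(c r) c = ψ_c(r)`. -/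
theorem weight_mul {c : ℝ} (hc : 1 < c) {w : ℝ → ℝ}
    (hw : ∀ r, w r = if r ∈ Set.range (fun n : ℤ => c ^ n) then (r ^ 2)⁻¹ else 0) (r : ℝ) :
    c * w (c * r) * c = w r := by
  rw [hw, hw r]
  by_cases hr : r ∈ Set.range (fun n : ℤ => c ^ n)
  · rw [if_pos ((mem_range_zpow_mul_iff hc).2 hr), if_pos hr]
    have hc0 : c ≠ 0 := by positivity
    have hr0 : r ≠ 0 := by obtain ⟨n, rfl⟩ := hr; exact zpow_ne_zero _ hc0
    field_simp
  · rw [if_neg (mt (mem_range_zpow_mul_iff hc).1 hr), if_neg hr]; ring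

open scoped Classical in
/-- The junk weight equals `1` at radius `1 = c⁰`. -/
theorem weight_one {c : ℝ} {w : ℝ → ℝ}
    (hw : ∀ r, w r = if r ∈ Set.range (fun n : ℤ => c ^ n) then (r ^ 2)⁻¹ else 0) : w 1 = 1 := by
  rw [hw, if_pos ⟨0, zpow_zero c⟩]; norm_num

open scoped Classical in
/-- No lattice point of `c^ℤ` lies strictly between `1` and `c`. -/
theorem weight_eq_zero_of_mem_Ioo {c c' : ℝ} (hc : 1 < c) (h1 : 1 < c') (h2 : c' < c) {w : ℝ → ℝ}
    (hw : ∀ r, w r = if r ∈ Set.range (fun n : ℤ => c ^ n) then (r ^ 2)⁻¹ else 0) : w c' = 0 := by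
  rw [hw, if_neg]
  rintro ⟨n, hn⟩
  simp only at hn
  rcases le_or_gt n 0 with hn0 | hn0
  · have : c ^ n ≤ 1 := zpow_le_one_of_nonpos₀ hc.le hn0
    linarith
  · have : c ≤ c ^ n := by
      calc c = c ^ (1 : ℤ) := (zpow_one c).symm
        _ ≤ c ^ n := zpow_le_zpow_right₀ hc.le (by omega)
    linarith

open scoped Classical in
/-- **The junk slice `x ↦ ψ_c(‖x‖) • x` is `(c, R)`-RDSS-compatible for EVERY isometry `R`.** -/
theorem junkSlice_rdss {c : ℝ} (hc : 1 < c) {w : ℝ → ℝ}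
    (hw : ∀ r, w r = if r ∈ Set.range (fun n : ℤ => c ^ n) then (r ^ 2)⁻¹ else 0)
    (R : E ≃ₗᵢ[ℝ] E) (x : E) :
    c • R.symm (w ‖c • R x‖ • (c • R x)) = w ‖x‖ • x := by
  have hc0 : 0 < c := by linarith
  rw [norm_smul, Real.norm_of_nonneg hc0.le, R.norm_map, map_smul, map_smul, R.symm_apply_apply,
    smul_smul, smul_smul]
  congr 1
  calc _ = c * w (c * ‖x‖) * c := by ring
    _ = w ‖x‖ := weight_mul hc hw ‖x‖

open scoped Classical in
/-- **The junk slice breaks EVERY factor strictly between `1` and `c`, whatever the rotation.** -/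
theorem junkSlice_not_rdss {c c' : ℝ} (hc : 1 < c) (h1 : 1 < c') (h2 : c' < c) {w : ℝ → ℝ}
    (hw : ∀ r, w r = if r ∈ Set.range (fun n : ℤ => c ^ n) then (r ^ 2)⁻¹ else 0)
    (R' : E ≃ₗᵢ[ℝ] E) (e : E) (he : ‖e‖ = 1) :
    ¬ ∀ x : E, c' • R'.symm (w ‖c' • R' x‖ • (c' • R' x)) = w ‖x‖ • x := by
  intro h
  have key := h e
  rw [norm_smul, Real.norm_of_nonneg (by linarith : (0:ℝ) ≤ c'), R'.norm_map, he, mul_one,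
    weight_eq_zero_of_mem_Ioo hc h1 h2 hw, zero_smul, map_zero, smul_zero, weight_one hw, one_smul] at key
  have : e ≠ 0 := by
    intro h0; rw [h0, norm_zero] at he; exact zero_ne_one he
  exact this key.symm

end Junk

/-! ## §2 Certified misstatements on the tree decls -/

section Certificates

set_option linter.deprecated false in
/-- **THE JUNK EXTENSION LEMMA.** A `(c, R)`-RDSS field (`1 < c`) has a modification on `t ≥ 0` ONLY which is
still `(c, R)`-RDSS and admits NO rotated-DSS symmetry with factor in `(1, c)`: glue the junk slice
`x ↦ ψ_c(‖x‖) • x` onto `t ≥ 0`. -/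
theorem exists_junk_extension {c : ℝ} (hc : 1 < c)
    {R : EuclideanSpace ℝ (Fin 3) ≃ₗᵢ[ℝ] EuclideanSpace ℝ (Fin 3)}
    {u : ℝ → EuclideanSpace ℝ (Fin 3) → EuclideanSpace ℝ (Fin 3)} (hR : IsRotatedDSS c R u) :
    ∃ u' : ℝ → EuclideanSpace ℝ (Fin 3) → EuclideanSpace ℝ (Fin 3),
      (∀ s : ℝ, s < 0 → u' s = u s) ∧ IsRotatedDSS c R u' ∧
      ∀ (c' : ℝ) (R' : EuclideanSpace ℝ (Fin 3) ≃ₗᵢ[ℝ] EuclideanSpace ℝ (Fin 3)),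
        1 < c' → c' < c → ¬ IsRotatedDSS c' R' u' := by
  classical
  obtain ⟨w, hw⟩ : ∃ w : ℝ → ℝ, ∀ r, w r = if r ∈ Set.range (fun n : ℤ => c ^ n) then (r ^ 2)⁻¹ else 0 :=
    ⟨_, fun r => rfl⟩
  obtain ⟨u', hu'⟩ : ∃ u' : ℝ → EuclideanSpace ℝ (Fin 3) → EuclideanSpace ℝ (Fin 3),
      ∀ t x, u' t x = if t < 0 then u t x else w ‖x‖ • x := ⟨_, fun t x => rfl⟩
  have hneg : ∀ s : ℝ, s < 0 → u' s = u s := fun s hs => by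
    funext x; rw [hu', if_pos hs]
  have hnonneg : ∀ s : ℝ, 0 ≤ s → u' s = fun x => w ‖x‖ • x := fun s hs => by
    funext x; rw [hu', if_neg (not_lt.2 hs)]
  refine ⟨u', hneg, fun s x => ?_, fun c' R' h1 h2 hR' => ?_⟩
  · rcases lt_or_ge s 0 with hs | hs
    · have hcs : c ^ 2 * s < 0 := mul_neg_of_pos_of_neg (by positivity) hs
      rw [hneg s hs, hneg _ hcs]; exact hR s x
    · have hcs : 0 ≤ c ^ 2 * s := mul_nonneg (sq_nonneg c) hs
      rw [hnonneg s hs, hnonneg _ hcs]; exact junkSlice_rdss hc hw R x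
  · refine junkSlice_not_rdss hc h1 h2 hw R' (EuclideanSpace.single (0 : Fin 3) (1 : ℝ))
      (by rw [EuclideanSpace.norm_single, norm_one]) fun x => ?_
    have key := hR' 0 x
    rwa [mul_zero, hnonneg 0 le_rfl] at key

/-- **THE FAKE BREATHER** (certificate 1, ⟹): B `IsolatedFactorLiouville` (stmt-33310) proves EVERY rotated
Type-I DSS Liouville statement — apply B to the junk extension of the given member (same past, same class,
isolated factor set with `l = c`). -/
theorem rotated_of_isolated (hB : RootDecompFactorLadder.IsolatedFactorLiouville) (c : ℝ)
    (R : EuclideanSpace ℝ (Fin 3) ≃ₗᵢ[ℝ] EuclideanSpace ℝ (Fin 3)) : RotatedTypeIDSSLiouville c R := by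
  intro hc u hm hme hR hd t ht
  obtain ⟨u', heq, hR', hiso⟩ := exists_junk_extension hc hR
  have hm' : IsAncientMildSolution 1 u' := isAncientMildSolution_congr hm heq
  have hme' : ∀ s : ℝ, s < 0 → AEStronglyMeasurable (u' s) volume := fun s hs => by
    rw [heq s hs]; exact hme s hs
  have hd' : ∃ C₀ : ℝ, HasTypeIDecay C₀ u' := by
    obtain ⟨C₀, hC⟩ := hd; exact ⟨C₀, hasTypeIDecay_congr hC heq⟩
  have key := hB c R u' hc hm' hme' hR' hd' ⟨c, hc, hiso⟩ t ht
  rwa [heq t ht] at key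

/-- **CERTIFIED MISSTATEMENT: B ⟺ W.**  N26's declared residual B `IsolatedFactorLiouville` (stmt-33310, tagged
«WEAKER than W») **is** the wall W `TypeIDssWall` (stmt-29252) as typed (⟸: drop the isolation binder). -/
theorem isolated_iff_wall :
    RootDecompFactorLadder.IsolatedFactorLiouville ↔ RootDecompThresholdSaddle.TypeIDssWall :=
  ⟨fun hB => RootDecompThresholdSaddleWallOfCells.wall_iff_rotated.2 (rotated_of_isolated hB),
    fun hW c R u hc hm hme hR hd _ => (hW c).2 R hc u hm hme hR hd⟩

/-- Hence N26's cut `W ⟺ A ∧ B` is void on the B side: **B ⟺ W ∧ A** as typed (A `AccumulatingFactorLiouville`,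
stmt-33311) — stated as an `Iff` so that no route item is the head symbol of a landed theorem. -/
theorem isolated_iff_wall_and_accumulating : RootDecompFactorLadder.IsolatedFactorLiouville ↔
    RootDecompThresholdSaddle.TypeIDssWall ∧ RootDecompFactorLadder.AccumulatingFactorLiouville := by
  refine ⟨fun hB => ⟨isolated_iff_wall.1 hB, ?_⟩, fun h => isolated_iff_wall.2 h.1⟩
  intro u hm hme hd hacc t ht
  obtain ⟨c, R, hc, -, hR⟩ := hacc 1 one_pos
  exact ((isolated_iff_wall.1 hB) c).2 R hc u hm hme hR hd t ht

/-- **Certificate 2: C ⟺ C ∧ F on N15** (`CoarseRatioLargeEnvelopeDssLiouville` stmt-31466 swallows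
`FineRatioLargeEnvelopeDssLiouville` stmt-31465; `Iff` form, no item as head symbol): a fine-factor member
(`c ≤ 2`) is `(cᵏ, Q)`-RDSS with `cᵏ > 2` (group law, `isRotatedDSS_pow_exists`); its junk extension at factor `cᵏ` has NO factor in `(1, cᵏ) ⊇ (1, 2]`,
same past, same envelope. -/
theorem coarse_iff_coarse_and_fine : RootDecompThresholdSaddle.CoarseRatioLargeEnvelopeDssLiouville ↔
    RootDecompThresholdSaddle.CoarseRatioLargeEnvelopeDssLiouville ∧
      RootDecompThresholdSaddle.FineRatioLargeEnvelopeDssLiouville := by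
  refine ⟨fun hC => ⟨hC, ?_⟩, fun h => h.1⟩
  intro c R u hc hc2 hm hme hR hd hn3 t ht
  obtain ⟨k, hk⟩ := pow_unbounded_of_one_lt (2 : ℝ) hc
  obtain ⟨Q, hQ⟩ := RootDecompFactorLadderTwoFactorTransfer.isRotatedDSS_pow_exists hR k
  have hck : 1 < c ^ k := by linarith
  obtain ⟨u', heq, hR', hiso⟩ := exists_junk_extension hck hQ
  have hm' : IsAncientMildSolution 1 u' := isAncientMildSolution_congr hm heq
  have hme' : ∀ s : ℝ, s < 0 → AEStronglyMeasurable (u' s) volume := fun s hs => by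
    rw [heq s hs]; exact hme s hs
  have hd' : ∃ C₀ : ℝ, HasTypeIDecay C₀ u' := by
    obtain ⟨C₀, hC0⟩ := hd; exact ⟨C₀, hasTypeIDecay_congr hC0 heq⟩
  have hn3' : ¬ HasTypeIDecay 3 u' := fun h3 =>
    hn3 (hasTypeIDecay_congr h3 fun s hs => (heq s hs).symm)
  have hiso' : ∀ (c' : ℝ) (R' : EuclideanSpace ℝ (Fin 3) ≃ₗᵢ[ℝ] EuclideanSpace ℝ (Fin 3)),
      1 < c' → c' ≤ 2 → ¬ IsRotatedDSS c' R' u' :=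
    fun c' R' h1 h2 => hiso c' R' h1 (lt_of_le_of_lt h2 hk)
  have key := hC (c ^ k) Q u' hck hm' hme' hR' hiso' hd' hn3' t ht
  rwa [heq t ht] at key

/-- **CERTIFIED: N15's dial 2 is void as typed — `W ⟺ T ∧ C`** (T `SmallEnvelopeDssLiouville` stmt-31464); F is
swallowed by C, and `T → F → C → W` is the route's glue `TypeIDssWall_of_cells` (re-proved inline: cases on the
envelope `3` and on a fine factor). -/
theorem wall_iff_small_and_coarse : RootDecompThresholdSaddle.TypeIDssWall ↔
    RootDecompThresholdSaddle.SmallEnvelopeDssLiouville ∧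
      RootDecompThresholdSaddle.CoarseRatioLargeEnvelopeDssLiouville := by
  refine ⟨fun hW => ⟨fun c R u hc hm hme hR h3 => (hW c).2 R hc u hm hme hR ⟨3, h3⟩,
    fun c R u hc hm hme hR _ hd _ => (hW c).2 R hc u hm hme hR hd⟩, fun h => ?_⟩
  obtain ⟨hT, hC⟩ := h
  have hF := (coarse_iff_coarse_and_fine.1 hC).2
  refine RootDecompThresholdSaddleWallOfCells.wall_iff_rotated.2 fun c R hc u hm hme hR hd t ht => ?_
  by_cases h3 : HasTypeIDecay 3 u
  · exact hT c R u hc hm hme hR h3 t ht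
  by_cases hfine : ∃ (c' : ℝ) (R' : EuclideanSpace ℝ (Fin 3) ≃ₗᵢ[ℝ] EuclideanSpace ℝ (Fin 3)),
      1 < c' ∧ c' ≤ 2 ∧ IsRotatedDSS c' R' u
  · obtain ⟨c', R', h1, h2, hR'⟩ := hfine
    exact hF c' R' u h1 h2 hm hme hR' hd h3 t ht
  · simp only [not_exists, not_and] at hfine
    exact hC c R u hc hm hme hR (fun c' R' h1 h2 => hfine c' R' h1 h2) hd h3 t ht

end Certificates

/-! ## Exactness of the REPAIRED cuts (N26 rev 3, N15 resplit kit)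

The repaired pieces are read on PINNED, PAST-CONTINUOUS representatives: REG `TypeIRdssRepresentative` (stmt-27745,
rendered on both route files with the same body), B^R `PastIsolatedFactorLiouville` (stmt-27744, N26 crux rank 2),
C^R `PastCoarseRatioLargeEnvelopeDssLiouville` (stmt-27776, N15 aside pending the tenure resplit). Each is a
CONSEQUENCE of W (drop binders; `V := 0` for REG) and together they REBUILD W — so both repaired cuts are exact
modulo the expected theorem REG, with no junk available (pinning turns an RDSS identity on the past into
`IsRotatedDSS`; continuity makes the symmetry group an invariant of the slice-a.e. class). -/

section RepairedCuts

/-- The two rendered copies of REG (N26 file / N15 file) are syntactically equal. -/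
theorem reg_iff_reg : RootDecompThresholdSaddle.TypeIRdssRepresentative ↔
    RootDecompFactorLadder.TypeIRdssRepresentative := Iff.rfl

/-- `W ⟺ W ∧ REG`: the wall gives REG with the representative `V := 0` (an `Iff`, so REG — a route item — is
not the head symbol of a landed theorem). -/
theorem wall_iff_wall_and_reg : RootDecompThresholdSaddle.TypeIDssWall ↔
    RootDecompThresholdSaddle.TypeIDssWall ∧ RootDecompFactorLadder.TypeIRdssRepresentative := by
  refine ⟨fun hW => ⟨hW, ?_⟩, fun h => h.1⟩
  intro c R u hc hm hme hR hd
  refine ⟨fun _ _ => 0, fun t ht => ((hW c).2 R hc u hm hme hR hd t ht).symm, ?_, fun t _ => ?_, ?_,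
    fun t _ => rfl, fun t x => by simp, ⟨0, fun t _ x => by simp⟩⟩
  · exact ⟨fun t _ θ _ => by simp, fun s t _ _ φ _ _ => by simp⟩
  · exact aestronglyMeasurable_const
  · exact continuousOn_const

/-- **EXACTNESS OF N26 rev 3: `W ⟺ REG ∧ A ∧ B^R`** — the deciding theorem's inline rebuild of W, and its converse. -/
theorem wall_iff_repaired : RootDecompThresholdSaddle.TypeIDssWall ↔
    RootDecompFactorLadder.TypeIRdssRepresentative ∧ RootDecompFactorLadder.AccumulatingFactorLiouville ∧
      RootDecompFactorLadder.PastIsolatedFactorLiouville := by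
  refine ⟨fun hW => ⟨(wall_iff_wall_and_reg.1 hW).2, fun u hm hme hd hacc t ht => ?_,
    fun c R u hc hm hme _ _ hR hd _ => (hW c).2 R hc u hm hme hR hd⟩, fun h => ?_⟩
  · obtain ⟨c, R, hc, -, hR⟩ := hacc 1 one_pos
    exact (hW c).2 R hc u hm hme hR hd t ht
  obtain ⟨hREG, hA, hBR⟩ := h
  refine RootDecompThresholdSaddleWallOfCells.wall_iff_rotated.2 fun c R hc u hm hme hR hd t ht => ?_
  obtain ⟨V, hVu, hVm, hVme, hVc, hV0, hVR, hVd⟩ := hREG c R u hc hm hme hR hd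
  refine (hVu t ht).symm.trans ?_
  by_cases hacc : ∀ ε : ℝ, 0 < ε → ∃ (c' : ℝ) (R' : EuclideanSpace ℝ (Fin 3) ≃ₗᵢ[ℝ] EuclideanSpace ℝ (Fin 3)),
      1 < c' ∧ c' < 1 + ε ∧ IsRotatedDSS c' R' V
  · exact hA V hVm hVme hVd hacc t ht
  · simp only [not_forall, not_exists, not_and] at hacc
    obtain ⟨ε, hε, hno⟩ := hacc
    exact hBR c R V hc hVm hVme hVc hV0 hVR hVd ⟨1 + ε, by linarith, fun c' R' h1 h2 => hno c' R' h1 h2⟩ t ht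

/-- **EXACTNESS OF THE N15 RESPLIT KIT: `W ⟺ T ∧ F ∧ C^R ∧ REG`** (T stmt-31464, F stmt-31465, C^R stmt-27776,
REG stmt-27745) — the glue `T → F → C^R → REG → W` for the tenure resplit of W is the `←` direction. -/
theorem wall_iff_repaired_cells : RootDecompThresholdSaddle.TypeIDssWall ↔
    RootDecompThresholdSaddle.SmallEnvelopeDssLiouville ∧ RootDecompThresholdSaddle.FineRatioLargeEnvelopeDssLiouville ∧
      RootDecompThresholdSaddle.PastCoarseRatioLargeEnvelopeDssLiouville ∧
        RootDecompThresholdSaddle.TypeIRdssRepresentative := by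
  refine ⟨fun hW => ⟨fun c R u hc hm hme hR h3 => (hW c).2 R hc u hm hme hR ⟨3, h3⟩,
    fun c R u hc _ hm hme hR hd _ => (hW c).2 R hc u hm hme hR hd,
    fun c R u hc hm hme _ _ hR _ hd _ => (hW c).2 R hc u hm hme hR hd,
    reg_iff_reg.2 (wall_iff_wall_and_reg.1 hW).2⟩, fun h => ?_⟩
  obtain ⟨hT, hF, hCR, hREG⟩ := h
  refine RootDecompThresholdSaddleWallOfCells.wall_iff_rotated.2 fun c R hc u hm hme hR hd t ht => ?_
  obtain ⟨V, hVu, hVm, hVme, hVc, hV0, hVR, hVd⟩ := hREG c R u hc hm hme hR hd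
  refine (hVu t ht).symm.trans ?_
  by_cases h3 : HasTypeIDecay 3 V
  · exact hT c R V hc hVm hVme hVR h3 t ht
  by_cases hfine : ∃ (c' : ℝ) (R' : EuclideanSpace ℝ (Fin 3) ≃ₗᵢ[ℝ] EuclideanSpace ℝ (Fin 3)),
      1 < c' ∧ c' ≤ 2 ∧ IsRotatedDSS c' R' V
  · obtain ⟨c', R', h1, h2, hR'⟩ := hfine
    exact hF c' R' V h1 h2 hVm hVme hR' hVd h3 t ht
  · simp only [not_exists, not_and] at hfine
    exact hCR c R V hc hVm hVme hVc hV0 hVR (fun c' R' h1 h2 => hfine c' R' h1 h2) hVd h3 t ht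

end RepairedCuts

end Summit.NavierStokesRegularity.NavierStokesRegularity.Theorems.RootDecompFactorLadderFakeBreather
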